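import Literature.MathematicalPhysics.QuantumFieldTheory.BalabanImbrieJaffe1984to88.BIJ88CondMoments305
import Literature.MathematicalPhysics.QuantumFieldTheory.BalabanImbrieJaffe1984to88.BIJ88DexpCondMean305
import Literature.MathematicalPhysics.QuantumFieldTheory.BalabanImbrieJaffe1984to88.BIJ88CumulantAllOrders5133

/-!
# `BalabanImbrieJaffe1984to88.BIJ88DexpCondMeanCov305` — T. Bałaban, J. Imbrie, A. Jaffe, *Effective action and cluster properties of the abelian
Higgs model*, Commun. Math. Phys. **114** (1988) 257–315 [BalabanImbrieJaffe1988], Sect. 5.13 p. 305–307 [PDF 49–51] (with [Balaban1982Higgs2]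
(2.28)–(2.29) p. 563): **THE FIRST `s`-DERIVATIVE OF `⟨H⟩_s` ALONG A CUBE THE OBSERVABLE DOES NOT SEE IS A COVARIANCE WITH A QUADRATIC FORM
IN THE CONDITIONAL MEAN** — the smoothness-free form of the p. 307 join mechanism (*"Each time some □_i's are joined, we have s-derivatives,
which produce functional derivatives, chains of covariances C_ω(α) …  If the walk ω(α) wanders through more than a few cubes, we begin to pickup
factors e^{−cr(e_k)}"*).  p13's engine gives `∂{n}⟨H⟩(s) = −⟨D_n ; H⟩_s` (`BIJ88CumulantAllOrders5133.dexp_singleton`, `D_n = Σ_{l≠n}s_l⟨□_nΦ,Δ□_lΦ⟩`);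
if `H` depends only on the fields OFF a set of sites `Λ` (`Λ ∋` every site of `□_n` and every site `□_n` is coupled to by `Δ`), the conditional
Gaussian integration over `φ↾Λ` ([Balaban1982Higgs2] (2.28), tree carrier `B2Eq228Conditioning`; conditional second moments
`BIJ88CondMoments305.integral_mul_mul_conditioning`) replaces `D_n` by `D_n ∘ cm + c₀`, `cm(φ) = (μ(φ↾Λᶜ) on Λ, φ on Λᶜ)` the CONDITIONAL-MEAN
configuration (`μ(y) = A_Λ⁻¹(f↾Λ − A_{ΛΛᶜ}y)`, `A = Δ_s`; print's (2.29): `Σ_{b∈st(Λ)} C_Λ^{(0)}(x,b₋)A(b₋,b₊)φ(b₊)` — the DECAY of `C_Λ^{(0)}`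
between `□_n` and `∂Λ` is where letter (i) of the re-scoped flip item enters) and `c₀` a constant that cancels in the truncation:

  `∂{n}⟨H⟩(s) = −⟨D_n ∘ cm ; H⟩_s`,  hence  `|∂{n}⟨H⟩(s)| ≤ 2‖H‖_∞ · ⟨|D_n ∘ cm − a|⟩_s`  for every constant `a`.

No differentiability of `H` is used (p13's walk form `BIJ88WalkFormOrderOne5133.dexp_singleton_walk` needs `H ∈ C²`, unavailable for the modulus
slot fields of the §5.13 model without new ∇-letters).

statement-level skeleton of published theorems with citation tags; proofs where landed; nothing here is a claim about the Yang–Mills mass gap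

PDF held: `paper:balaban1988-cmp114-bij-abelian-higgs-effective-action` (journal page = PDF page + 256); p. 305 (text layer p0049), verbatim: *"the
first derivative produces a term ⟨Σ_{j≠i} s_j⟨□_iΦ, Δ□_jΦ⟩; Π f(□_i)⟩_{s_Γ}"*; p. 307 (p0051) as quoted above.

WHAT IS PROVED (unit `lit-balaban-p36`, generation 19 of the Phase-2 proof seat p36; SKELETON rows C2.Eq5.14.3-5.14.4 / C2.Eq5.13.3-5.13.4 of
`HOME/lit-balaban-r16/ROWS-C2-part2.md`, owner r16 — engine-level infrastructure for the re-scoped flip item (v2.253); 0 definitions, 0 `Prop`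
facts, theorems only).  Data: p13's engine (`num`, `Dfun`, `dexp`), an arbitrary decidable set of integrated sites `Λ = {p}` containing `□_n` and
every site `□_n` couples to (`hpn`, `hfar`), a bounded measurable observable `H` of the fields off `Λ` (`hloc`).
* **`num_pair_eq`** (one pair of sites: `N(a_{xy}φ_xφ_y H) = N(a_{xy}[cm_x cm_y + (A_Λ⁻¹)_{xy}] H)`), **`num_Dfun_mul_eq`**
  (`N(D_n H) = N((D_n∘cm) H) + c₀ N(H)`), **`dexp_singleton_eq_condMean`** (`∂{n}⟨H⟩(s) = −(⟨(D_n∘cm)H⟩_s − ⟨D_n∘cm⟩_s⟨H⟩_s)`),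
  **`abs_dexp_singleton_le_condMean`** (`|∂{n}⟨H⟩(s)| ≤ 2K₀·⟨|D_n∘cm − a|⟩_s`, `‖H‖ ≤ K₀`, any `a`).
HONEST SCOPE: an identity and a bound at p13's engine level; the smallness of `⟨|D_n∘cm − a|⟩_s` (decay letter (i) through the rows of
`A_Λ⁻¹A_{ΛΛᶜ}`) and any (5.14.4) instance are NOT here.  Imports `BIJ88CondMoments305`, `BIJ88DexpCondMean305` (p36 g19) and
`BIJ88CumulantAllOrders5133` (p13); modifies nothing.  NOT summit progress; NOT continuum; NOT Clay.  Cell `lit-balaban` Phase 2, seat p36 gen 19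
(owner r16, referee ref-5).
-/

noncomputable section

open MeasureTheory Matrix Finset Filter
open scoped BigOperators

namespace Literature.MathematicalPhysics.QuantumFieldTheory.BalabanImbrieJaffe1984to88.BIJ88DexpCondMeanCov305

open Literature.MathematicalPhysics.QuantumFieldTheory.Balaban1983to89
open B2Eq228Conditioning (In Out resIn resOut glue blkIn blkMix condShift weight source continuous_condShift measurable_glue
  measurable_resOut)
open BIJ88DirichletForms305 (interpForm boxProj boxProj_mulVec_apply interpForm_posDef quadForm_interpForm_ge)
open BIJ88DirichletDeriv305 (blockPair)
open BIJ88SecondOrder5133 (num Dfun integrable_growth_of_lower)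
open BIJ88SDerivative305 (integral_weight_mul_source_pos)
open BIJ88CumulantAllOrders5133 (dexp dexp_singleton)
open BIJ88CondMoments305 (integral_mul_mul_conditioning)
open BIJ88DexpCondMean305 (Dfun_eq_sum_sum coeff_eq_zero_of_not measurable_cm_apply integrable_apply_mul_apply_mul integrable_cm_mul_cm_mul
  integrable_Dfun_cm_sub_mul integrable_abs_Dfun_cm_sub_mul num_const_mul num_add num_sum_sum)

variable {α I : Type} [Fintype α] [DecidableEq α] [Fintype I] [DecidableEq I] (blk : α → I) {Δ : Matrix α α ℝ}

variable (hΔ : Δ.PosDef) {c : ℝ} (hc : 0 < c) (hcΔ : ∀ v, c * (v ⬝ᵥ v) ≤ v ⬝ᵥ (Δ *ᵥ v))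
  (f : α → ℝ) {s : I → ℝ} (hs : ∀ l, 0 ≤ s l ∧ s l ≤ 1) (p : α → Prop) [DecidablePred p] {n : I}
  (hpn : ∀ x, blk x = n → p x) (hfar : ∀ x y, blk x = n → ¬ p y → Δ x y = 0)
  {H : (α → ℝ) → ℝ} (hHm : Measurable H) {K₀ : ℝ} (hK : ∀ φ, ‖H φ‖ ≤ K₀)
  (hloc : ∀ φ ψ : α → ℝ, (∀ x, ¬ p x → φ x = ψ x) → H φ = H ψ)

include hΔ hc hcΔ hs hpn hfar hHm hK hloc in
/-- **One pair of sites**: `N(a_{xy} φ_xφ_y H) = N(a_{xy}[cm_x cm_y + κ_{xy}] H)`, `κ_{xy} = (A_Λ⁻¹)_{xy}` on `Λ × Λ` (by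
`BIJ88CondMoments305.integral_mul_mul_conditioning` when `x, y ∈ Λ`; both sides vanish otherwise).  [cite: Balaban1982Higgs2, (2.28) p.563] -/
theorem num_pair_eq (x y : α) :
    num blk Δ f (fun φ => (if blk x = n ∧ blk y ≠ n then s (blk y) * Δ x y else 0) * (φ x * φ y) * H φ) s
      = num blk Δ f (fun φ => (if blk x = n ∧ blk y ≠ n then s (blk y) * Δ x y else 0) *
          (glue p (condShift p (interpForm blk Δ s) f (resOut p φ)) (resOut p φ) x *
              glue p (condShift p (interpForm blk Δ s) f (resOut p φ)) (resOut p φ) y +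
            (if hx : p x then (if hy : p y then (blkIn p (interpForm blk Δ s))⁻¹ ⟨x, hx⟩ ⟨y, hy⟩ else 0) else 0)) * H φ) s := by
  set A := interpForm blk Δ s with hAdef
  have hA : A.PosDef := interpForm_posDef blk hΔ hs
  have hcA : ∀ v, c * (v ⬝ᵥ v) ≤ v ⬝ᵥ (A *ᵥ v) := quadForm_interpForm_ge blk hcΔ hs
  set G₀ : (Out p → ℝ) → ℝ := fun z => H (glue p 0 z) with hG₀
  have hHG : ∀ φ : α → ℝ, H φ = G₀ (resOut p φ) := fun φ =>
    hloc φ _ fun z hz => by simp [glue, hz, resOut]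
  have hG : Measurable G₀ := hHm.comp ((measurable_glue p).comp (measurable_const.prodMk measurable_id))
  have hGb : ∀ z, |G₀ z| ≤ K₀ := fun z => by have h := hK (glue p 0 z); rwa [Real.norm_eq_abs] at h
  by_cases hxy : p x ∧ p y
  · obtain ⟨hx, hy⟩ := hxy
    have key := integral_mul_mul_conditioning p f hA hc hcA hG hGb ⟨x, hx⟩ ⟨y, hy⟩
    have hgx : ∀ φ : α → ℝ, glue p (condShift p A f (resOut p φ)) (resOut p φ) x = condShift p A f (resOut p φ) ⟨x, hx⟩ :=
      fun φ => by simp [glue, hx]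
    have hgy : ∀ φ : α → ℝ, glue p (condShift p A f (resOut p φ)) (resOut p φ) y = condShift p A f (resOut p φ) ⟨y, hy⟩ :=
      fun φ => by simp [glue, hy]
    simp only [num, dif_pos hx, dif_pos hy, hgx, hgy]
    calc ∫ φ : α → ℝ, (if blk x = n ∧ blk y ≠ n then s (blk y) * Δ x y else 0) * (φ x * φ y) * H φ * (weight A φ * source f φ)
        = (if blk x = n ∧ blk y ≠ n then s (blk y) * Δ x y else 0) *
            ∫ φ : α → ℝ, weight A φ * (source f φ * (φ x * φ y) * G₀ (resOut p φ)) := by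
          rw [← integral_const_mul]
          refine integral_congr_ae (Eventually.of_forall fun φ => ?_)
          simp only [hHG φ]; ring
      _ = (if blk x = n ∧ blk y ≠ n then s (blk y) * Δ x y else 0) *
            ∫ φ : α → ℝ, weight A φ * (source f φ * G₀ (resOut p φ) *
              ((blkIn p A)⁻¹ ⟨x, hx⟩ ⟨y, hy⟩ + condShift p A f (resOut p φ) ⟨x, hx⟩ * condShift p A f (resOut p φ) ⟨y, hy⟩)) := by
          rw [key]
      _ = _ := by
          rw [← integral_const_mul]
          refine integral_congr_ae (Eventually.of_forall fun φ => ?_)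
          simp only [hHG φ]; ring
  · have ha : (if blk x = n ∧ blk y ≠ n then s (blk y) * Δ x y else 0) = 0 := coeff_eq_zero_of_not blk Δ p s hpn hfar hxy
    simp only [ha, zero_mul]

include hΔ hc hcΔ hs hpn hfar hHm hK hloc in
/-- **`N(D_n H) = N((D_n ∘ cm) H) + c₀·N(H)`**: against an observable of the fields off `Λ`, the quadratic form `D_n` (supported on `Λ × Λ`)
may be replaced by the same form OF THE CONDITIONAL-MEAN CONFIGURATION `cm(φ) = (A_Λ⁻¹(f↾Λ − A_{ΛΛᶜ}φ↾Λᶜ) on Λ, φ on Λᶜ)`, `A = Δ_s`, up to the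
constant `c₀ = Σ_{x,y∈Λ} a_{xy}(A_Λ⁻¹)_{xy}`. [cite: Balaban1982Higgs2, (2.28)–(2.29) p.563] -/
theorem num_Dfun_mul_eq :
    num blk Δ f (fun φ => Dfun blk Δ s n φ * H φ) s
      = num blk Δ f (fun φ => Dfun blk Δ s n (glue p (condShift p (interpForm blk Δ s) f (resOut p φ)) (resOut p φ)) * H φ) s
        + (∑ x, ∑ y, (if blk x = n ∧ blk y ≠ n then s (blk y) * Δ x y else 0) *
            (if hx : p x then (if hy : p y then (blkIn p (interpForm blk Δ s))⁻¹ ⟨x, hx⟩ ⟨y, hy⟩ else 0) else 0))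
          * num blk Δ f H s := by
  -- integrability of the three kinds of terms
  have hI1 : ∀ x y, Integrable fun φ : α → ℝ =>
      (if blk x = n ∧ blk y ≠ n then s (blk y) * Δ x y else 0) * (φ x * φ y) * H φ * (weight (interpForm blk Δ s) φ * source f φ) := fun x y => by
    have h := (integrable_apply_mul_apply_mul blk hcΔ f hs hHm hK hc x y).const_mul (if blk x = n ∧ blk y ≠ n then s (blk y) * Δ x y else 0)
    refine h.congr (Eventually.of_forall fun φ => ?_)
    simp only; ring
  have hI2 : ∀ x y, Integrable fun φ : α → ℝ =>
      (if blk x = n ∧ blk y ≠ n then s (blk y) * Δ x y else 0) *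
        (glue p (condShift p (interpForm blk Δ s) f (resOut p φ)) (resOut p φ) x * glue p (condShift p (interpForm blk Δ s) f (resOut p φ)) (resOut p φ) y) * H φ *
          (weight (interpForm blk Δ s) φ * source f φ) := fun x y => by
    have h := (integrable_cm_mul_cm_mul blk hcΔ f hs p hHm hK hc (interpForm blk Δ s) x y).const_mul (if blk x = n ∧ blk y ≠ n then s (blk y) * Δ x y else 0)
    refine h.congr (Eventually.of_forall fun φ => ?_)
    simp only; ring
  have hIH : Integrable fun φ : α → ℝ => H φ * (weight (interpForm blk Δ s) φ * source f φ) := by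
    have hε : 2 * (c / 4) < c := by linarith
    have hK0 : 0 ≤ K₀ := (norm_nonneg _).trans (hK 0)
    refine integrable_growth_of_lower (quadForm_interpForm_ge blk hcΔ hs) f hHm.aestronglyMeasurable hε (K₀ := K₀) fun φ => ?_
    have h0 : 0 ≤ φ ⬝ᵥ φ := by rw [dotProduct]; exact Finset.sum_nonneg fun z _ => mul_self_nonneg _
    exact (hK φ).trans (le_mul_of_one_le_right hK0 (Real.one_le_exp (by positivity)))
  have hI3 : ∀ x y, Integrable fun φ : α → ℝ =>
      (if blk x = n ∧ blk y ≠ n then s (blk y) * Δ x y else 0) *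
        (if hx : p x then (if hy : p y then (blkIn p (interpForm blk Δ s))⁻¹ ⟨x, hx⟩ ⟨y, hy⟩ else 0) else 0) * H φ * (weight (interpForm blk Δ s) φ * source f φ) :=
    fun x y => by
    have h := hIH.const_mul ((if blk x = n ∧ blk y ≠ n then s (blk y) * Δ x y else 0) *
        (if hx : p x then (if hy : p y then (blkIn p (interpForm blk Δ s))⁻¹ ⟨x, hx⟩ ⟨y, hy⟩ else 0) else 0))
    refine h.congr (Eventually.of_forall fun φ => ?_)
    simp only; ring
  -- left side as a double sum of pair terms
  have hL : num blk Δ f (fun φ => Dfun blk Δ s n φ * H φ) s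
      = ∑ x, ∑ y, num blk Δ f (fun φ => (if blk x = n ∧ blk y ≠ n then s (blk y) * Δ x y else 0) * (φ x * φ y) * H φ) s := by
    rw [← num_sum_sum blk f s _ hI1]
    congr 1; funext φ
    rw [Dfun_eq_sum_sum, Finset.sum_mul]
    exact Finset.sum_congr rfl fun x _ => Finset.sum_mul _ _ _
  -- right side likewise
  have hR : num blk Δ f (fun φ => Dfun blk Δ s n (glue p (condShift p (interpForm blk Δ s) f (resOut p φ)) (resOut p φ)) * H φ) s
      = ∑ x, ∑ y, num blk Δ f (fun φ => (if blk x = n ∧ blk y ≠ n then s (blk y) * Δ x y else 0) *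
          (glue p (condShift p (interpForm blk Δ s) f (resOut p φ)) (resOut p φ) x * glue p (condShift p (interpForm blk Δ s) f (resOut p φ)) (resOut p φ) y) * H φ) s := by
    rw [← num_sum_sum blk f s _ hI2]
    congr 1; funext φ
    rw [Dfun_eq_sum_sum, Finset.sum_mul]
    exact Finset.sum_congr rfl fun x _ => Finset.sum_mul _ _ _
  have hC : (∑ x, ∑ y, (if blk x = n ∧ blk y ≠ n then s (blk y) * Δ x y else 0) *
        (if hx : p x then (if hy : p y then (blkIn p (interpForm blk Δ s))⁻¹ ⟨x, hx⟩ ⟨y, hy⟩ else 0) else 0)) * num blk Δ f H s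
      = ∑ x, ∑ y, num blk Δ f (fun φ => (if blk x = n ∧ blk y ≠ n then s (blk y) * Δ x y else 0) *
          (if hx : p x then (if hy : p y then (blkIn p (interpForm blk Δ s))⁻¹ ⟨x, hx⟩ ⟨y, hy⟩ else 0) else 0) * H φ) s := by
    rw [Finset.sum_mul]
    refine Finset.sum_congr rfl fun x _ => ?_
    rw [Finset.sum_mul]
    refine Finset.sum_congr rfl fun y _ => ?_
    rw [← num_const_mul]
  rw [hL, hR, hC, ← Finset.sum_add_distrib]
  refine Finset.sum_congr rfl fun x _ => ?_
  rw [← Finset.sum_add_distrib]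
  refine Finset.sum_congr rfl fun y _ => ?_
  rw [num_pair_eq blk hΔ hc hcΔ f hs p hpn hfar hHm hK hloc x y, ← num_add blk f s (hI2 x y) (hI3 x y)]
  simp only [num]
  refine integral_congr_ae (Eventually.of_forall fun φ => ?_)
  simp only
  ring

include hΔ hc hcΔ hs hpn hfar hHm hK hloc in
/-- **`∂{n}⟨H⟩(s) = −⟨D_n ∘ cm ; H⟩_s`**: the first `s`-derivative of the normalized interpolated expectation along a cube `n` whose sites, and
the sites they couple to, the observable does not see is MINUS THE COVARIANCE OF `H` WITH `D_n` EVALUATED AT THE CONDITIONAL MEAN (p. 305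
*"the first derivative produces a term ⟨Σ_{j≠i} s_j⟨□_iΦ, Δ□_jΦ⟩; Π f(□_i)⟩_{s_Γ}"* + [Balaban1982Higgs2] (2.28); the constant `c₀` cancels in the
truncation). [cite: BalabanImbrieJaffe1988, §5.13 p.305] -/
theorem dexp_singleton_eq_condMean :
    dexp blk Δ f H {n} s
      = -(num blk Δ f (fun φ => Dfun blk Δ s n (glue p (condShift p (interpForm blk Δ s) f (resOut p φ)) (resOut p φ)) * H φ) s
            / num blk Δ f (fun _ => 1) s
          - num blk Δ f (fun φ => Dfun blk Δ s n (glue p (condShift p (interpForm blk Δ s) f (resOut p φ)) (resOut p φ))) s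
            / num blk Δ f (fun _ => 1) s * (num blk Δ f H s / num blk Δ f (fun _ => 1) s)) := by
  have hZ : num blk Δ f (fun _ => (1 : ℝ)) s ≠ 0 := by
    have h := integral_weight_mul_source_pos (interpForm_posDef blk hΔ hs) f
    simp only [num, one_mul]
    exact h.ne'
  have h1 := num_Dfun_mul_eq blk hΔ hc hcΔ f hs p hpn hfar hHm hK hloc
  have h2 := num_Dfun_mul_eq blk hΔ hc hcΔ f hs p hpn hfar (H := fun _ => (1 : ℝ)) measurable_const (K₀ := 1) (fun _ => by simp)
    (fun _ _ _ => rfl)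
  have e1 : (fun φ : α → ℝ => Dfun blk Δ s n φ * (1 : ℝ)) = Dfun blk Δ s n := funext fun φ => mul_one _
  have e2 : (fun φ : α → ℝ => Dfun blk Δ s n (glue p (condShift p (interpForm blk Δ s) f (resOut p φ)) (resOut p φ)) * (1 : ℝ))
      = fun φ => Dfun blk Δ s n (glue p (condShift p (interpForm blk Δ s) f (resOut p φ)) (resOut p φ)) := funext fun φ => mul_one _
  rw [e1, e2] at h2
  have key : ∀ A' B' N' Z' c' : ℝ, Z' ≠ 0 →
      -((A' + c' * N') / Z' - (B' + c' * Z') / Z' * (N' / Z')) = -(A' / Z' - B' / Z' * (N' / Z')) := by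
    intro A' B' N' Z' c' hZ'
    field_simp
    ring
  rw [dexp_singleton, h1, h2]
  exact key _ _ _ _ _ hZ

include hΔ hc hcΔ hs hpn hfar hHm hK hloc in
/-- **`|∂{n}⟨H⟩(s)| ≤ 2K₀ · ⟨|D_n ∘ cm − a|⟩_s`** for every constant `a` (`‖H‖ ≤ K₀`): the whole size of the join along the cube `n` sits in the
fluctuation of the conditional-mean quadratic form — print's (2.29) boundary operator `A_Λ⁻¹A_{ΛΛᶜ}` applied to the far fields — which is where
the decay letter (i) of the re-scoped flip item is consumed. [cite: BalabanImbrieJaffe1988, §5.13 p.307] -/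
theorem abs_dexp_singleton_le_condMean (a : ℝ) :
    |dexp blk Δ f H {n} s| ≤ 2 * K₀ *
      (num blk Δ f (fun φ => |Dfun blk Δ s n (glue p (condShift p (interpForm blk Δ s) f (resOut p φ)) (resOut p φ)) - a|) s
        / num blk Δ f (fun _ => 1) s) := by
  set A := interpForm blk Δ s with hAdef
  set X : (α → ℝ) → ℝ := fun φ => Dfun blk Δ s n (glue p (condShift p A f (resOut p φ)) (resOut p φ)) with hX
  have hZpos : 0 < num blk Δ f (fun _ => (1 : ℝ)) s := by
    have h := integral_weight_mul_source_pos (interpForm_posDef blk hΔ hs) f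
    simp only [num, one_mul]
    exact h
  have hZ : num blk Δ f (fun _ => (1 : ℝ)) s ≠ 0 := hZpos.ne'
  have hK0 : 0 ≤ K₀ := (norm_nonneg _).trans (hK 0)
  -- integrability
  have hXaH : Integrable fun φ : α → ℝ => |X φ - a| * H φ * (weight A φ * source f φ) :=
    integrable_abs_Dfun_cm_sub_mul blk hcΔ f hs p hHm hK hc A n a
  have hXa1 : Integrable fun φ : α → ℝ => |X φ - a| * 1 * (weight A φ * source f φ) :=
    integrable_abs_Dfun_cm_sub_mul blk hcΔ f hs p (H := fun _ => (1 : ℝ)) measurable_const (K₀ := 1) (fun _ => by simp) hc A n a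
  have hXa : Integrable fun φ : α → ℝ => |X φ - a| * (weight A φ * source f φ) := by
    refine hXa1.congr (Eventually.of_forall fun φ => ?_); simp only [mul_one]
  have hws : ∀ φ : α → ℝ, 0 ≤ weight A φ * source f φ :=
    fun φ => mul_nonneg (B2Eq228Conditioning.weight_pos A φ).le (B2Eq228Conditioning.source_pos f φ).le
  -- the centred numerators
  have hXH : Integrable fun φ : α → ℝ => (X φ - a) * H φ * (weight A φ * source f φ) :=
    integrable_Dfun_cm_sub_mul blk hcΔ f hs p hHm hK hc A n a
  have hX1' : Integrable fun φ : α → ℝ => (X φ - a) * 1 * (weight A φ * source f φ) :=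
    integrable_Dfun_cm_sub_mul blk hcΔ f hs p (H := fun _ => (1 : ℝ)) measurable_const (K₀ := 1) (fun _ => by simp) hc A n a
  have hX1 : Integrable fun φ : α → ℝ => (X φ - a) * (weight A φ * source f φ) := by
    refine hX1'.congr (Eventually.of_forall fun φ => ?_); simp only [mul_one]
  -- |N((X−a)H)| ≤ K₀ N(|X−a|), |N(X−a)| ≤ N(|X−a|), |N(H)| ≤ K₀ N(1)
  have hB1 : |num blk Δ f (fun φ => (X φ - a) * H φ) s| ≤ K₀ * num blk Δ f (fun φ => |X φ - a|) s := by
    simp only [num]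
    rw [← integral_const_mul]
    refine (abs_integral_le_integral_abs).trans (integral_mono_of_nonneg (Eventually.of_forall fun φ => abs_nonneg _)
      (hXa.const_mul K₀) (Eventually.of_forall fun φ => ?_))
    simp only
    rw [abs_mul, abs_mul, abs_of_nonneg (hws φ)]
    have h := hK φ
    rw [Real.norm_eq_abs] at h
    calc |X φ - a| * |H φ| * (weight A φ * source f φ) ≤ |X φ - a| * K₀ * (weight A φ * source f φ) :=
        mul_le_mul_of_nonneg_right (mul_le_mul_of_nonneg_left h (abs_nonneg _)) (hws φ)
      _ = K₀ * (|X φ - a| * (weight A φ * source f φ)) := by ring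
  have hB2 : |num blk Δ f (fun φ => X φ - a) s| ≤ num blk Δ f (fun φ => |X φ - a|) s := by
    simp only [num]
    refine (abs_integral_le_integral_abs).trans (integral_mono_of_nonneg (Eventually.of_forall fun φ => abs_nonneg _) hXa
      (Eventually.of_forall fun φ => ?_))
    simp only
    rw [abs_mul, abs_of_nonneg (hws φ)]
  have hB3 : |num blk Δ f H s| ≤ K₀ * num blk Δ f (fun _ => (1 : ℝ)) s := by
    simp only [num, one_mul]
    rw [← integral_const_mul]
    have hIH : Integrable fun φ : α → ℝ => H φ * (weight A φ * source f φ) := by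
      have hε : 2 * (c / 4) < c := by linarith
      refine integrable_growth_of_lower (quadForm_interpForm_ge blk hcΔ hs) f hHm.aestronglyMeasurable hε (K₀ := K₀) fun φ => ?_
      have h0 : 0 ≤ φ ⬝ᵥ φ := by rw [dotProduct]; exact Finset.sum_nonneg fun z _ => mul_self_nonneg _
      exact (hK φ).trans (le_mul_of_one_le_right hK0 (Real.one_le_exp (by positivity)))
    refine (abs_integral_le_integral_abs).trans (integral_mono_of_nonneg (Eventually.of_forall fun φ => abs_nonneg _)
      ((B2Eq228Conditioning.integrable_weight_mul_source A f (interpForm_posDef blk hΔ hs)).const_mul K₀)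
      (Eventually.of_forall fun φ => ?_))
    simp only
    rw [abs_mul, abs_of_nonneg (hws φ)]
    have h := hK φ
    rw [Real.norm_eq_abs] at h
    calc |H φ| * (weight A φ * source f φ) ≤ K₀ * (weight A φ * source f φ) := mul_le_mul_of_nonneg_right h (hws φ)
      _ = _ := rfl
  -- centring: N(XH) = N((X−a)H) + aN(H), N(X) = N(X−a) + aN(1)
  have hIH : Integrable fun φ : α → ℝ => H φ * (weight A φ * source f φ) := by
    have hε : 2 * (c / 4) < c := by linarith
    refine integrable_growth_of_lower (quadForm_interpForm_ge blk hcΔ hs) f hHm.aestronglyMeasurable hε (K₀ := K₀) fun φ => ?_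
    have h0 : 0 ≤ φ ⬝ᵥ φ := by rw [dotProduct]; exact Finset.sum_nonneg fun z _ => mul_self_nonneg _
    exact (hK φ).trans (le_mul_of_one_le_right hK0 (Real.one_le_exp (by positivity)))
  have hc1 : num blk Δ f (fun φ => X φ * H φ) s = num blk Δ f (fun φ => (X φ - a) * H φ) s + a * num blk Δ f H s := by
    rw [← num_const_mul, ← num_add blk f s hXH (hIH.const_mul a |>.congr (Eventually.of_forall fun φ => by simp only; ring))]
    congr 1; funext φ; ring
  have hc2 : num blk Δ f X s = num blk Δ f (fun φ => X φ - a) s + a * num blk Δ f (fun _ => (1 : ℝ)) s := by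
    rw [← num_const_mul, ← num_add blk f s hX1 ((B2Eq228Conditioning.integrable_weight_mul_source A f
      (interpForm_posDef blk hΔ hs)).const_mul (a * 1) |>.congr (Eventually.of_forall fun φ => rfl))]
    congr 1; funext φ; ring
  rw [dexp_singleton_eq_condMean blk hΔ hc hcΔ f hs p hpn hfar hHm hK hloc]
  -- the covariance in centred form
  have hcov : num blk Δ f (fun φ => X φ * H φ) s / num blk Δ f (fun _ => 1) s
        - num blk Δ f X s / num blk Δ f (fun _ => 1) s * (num blk Δ f H s / num blk Δ f (fun _ => 1) s)
      = num blk Δ f (fun φ => (X φ - a) * H φ) s / num blk Δ f (fun _ => 1) s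
        - num blk Δ f (fun φ => X φ - a) s / num blk Δ f (fun _ => 1) s * (num blk Δ f H s / num blk Δ f (fun _ => 1) s) := by
    rw [hc1, hc2]
    field_simp
    ring
  rw [show (fun φ => Dfun blk Δ s n (glue p (condShift p (interpForm blk Δ s) f (resOut p φ)) (resOut p φ)) * H φ) = fun φ => X φ * H φ
    from rfl, show (fun φ => Dfun blk Δ s n (glue p (condShift p (interpForm blk Δ s) f (resOut p φ)) (resOut p φ))) = X from rfl, hcov,
    abs_neg]
  set Z := num blk Δ f (fun _ => (1 : ℝ)) s with hZdef
  set N := num blk Δ f (fun φ => |X φ - a|) s with hNdef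
  have hN0 : 0 ≤ N := by
    simp only [hNdef, num]
    exact integral_nonneg fun φ => mul_nonneg (abs_nonneg _) (hws φ)
  calc |num blk Δ f (fun φ => (X φ - a) * H φ) s / Z - num blk Δ f (fun φ => X φ - a) s / Z * (num blk Δ f H s / Z)|
      ≤ |num blk Δ f (fun φ => (X φ - a) * H φ) s / Z| + |num blk Δ f (fun φ => X φ - a) s / Z * (num blk Δ f H s / Z)| := abs_sub _ _
    _ = |num blk Δ f (fun φ => (X φ - a) * H φ) s| / Z + |num blk Δ f (fun φ => X φ - a) s| / Z * (|num blk Δ f H s| / Z) := by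
        rw [abs_mul, abs_div, abs_div, abs_div, abs_of_pos hZpos]
    _ ≤ K₀ * N / Z + N / Z * (K₀ * Z / Z) := by
        gcongr
    _ = 2 * K₀ * (N / Z) := by field_simp; ring


end Literature.MathematicalPhysics.QuantumFieldTheory.BalabanImbrieJaffe1984to88.BIJ88DexpCondMeanCov305

end
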